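import Literature.IUT.HodgeArakelov.MonoThetaCyclotomes
import Literature.IUT.HodgeArakelov.RadialEnvironments
import Literature.IUT.HodgeArakelov.RadialExamples
import Mathlib.GroupTheory.Torsion
import Mathlib.GroupTheory.MonoidLocalization.Basic

/-!
# [IUTchII] §1, Example 1.8 (ii)–(ix), Remark 1.8.1: the [AbsTopIII] output data (INTERFACE)

Mochizuki, *Inter-universal Teichmüller theory II*, §1, Example 1.8 (ii)–(ix), Remark 1.8.1, kurims manuscript
(Dec. 2020) pp. 36–42 [claim: Mochizuki2012, status: disputed] (IUTchII §1 Ex 1.8, kurims pp.36-42). Record-only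
typing under the claim key `Mochizuki2012` (D-0012, disputed).

Example 1.8 (ii)–(ix) quotes the OUTPUTS of functorial algorithms of [AbsTopIII] §3, §5: `(*TM) Π ↦ Π ↷ M_TM(Π)`,
`(*⊳) G ↦ G ↷ O^⊳(G)`, `(*TM⊳)`, `(*×)`, `(*μ)`, `(*×μ)`, `(*gp)`, `(*ĝp)`, `Ism(G)`, the log-shell `I(G)`. They
are not constructed in the tree; this file carries them as INTERFACE structures (`AbsTopMonoids`,
`ProfiniteGroupifications`; TODO-merge:abc-iut-L4-t2 [AbsTopIII] §3, abc-iut-L4-t3 [AbsTopIII] §5 Prop. 5.8;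
monoids WITHOUT their ind-topologies; the log-shell `I(G)` is DEFINED from them as printed), over which Corollaries 1.11 and 1.12 are typed, and types
`IUTchII:Rmk1.8.1` as a named `Prop` over the interface. The radial ENVIRONMENTS of (ii)–(ix) are in
`RadialExamples.lean` (shape `ex18iii`).
-/

namespace Literature.IUT.HodgeArakelov

open CategoryTheory

universe u

variable (S : ThetaSetting.{u})

/-! ## The [AbsTopIII] monoids (INTERFACE) -/

/-- INTERFACE for **IUTchII:Ex1.8(ii)**–**(ix)** (kurims pp. 36–41): the outputs of the functorial
group-theoretic algorithms of [AbsTopIII] §3, §5 quoted there — `(*TM) Π ↦ (Π ↷ M_TM(Π))` "an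
MLF-Galois TM-pair … isomorphic to the model … determined by the natural action of `Π^tp_{X̲̲_k}` on the
ind-topological monoid `O^⊳_{k̄}`" ([AbsTopIII] Def. 3.1 (vi), Cor. 3.6 (ii)); `(*⊳) G ↦ (G ↷ O^⊳(G))`
([AbsTopIII] Prop. 5.8 (i)); the tautological isomorphism `(*TM⊳) (Π ↷ M_TM(Π)) ≅ (Π/Δ ↷ O^⊳(Π/Δ))|_Π`
([AbsTopIII] Prop. 3.2 (iv)); the sub-objects of invertible elements `(*×)`, of torsion elements `(*μ)`,
the quotients `O^{×μ} := O^×/O^μ` `(*×μ)`, the groupifications `(*gp)` and their profinite-completion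
version `(*ĝp)`, the group `Ism(G)` of `G`-isometries of `O^{×μ}(G)`, and the log-shell
`I(G) ⊆ O^{×μ}(G)` "[`p⁻¹` times the image of the `G`-invariants of `O^×(G)` in `O^{×μ}(G)` — cf.
[AbsTopIII], Proposition 5.8, (ii)]". Carried per object of `IsoClass`, as abstract monoids/groups with
actions by automorphisms (ind-topologies NOT modelled), functorially in isomorphisms. TODO-merge:
abc-iut-L4-t2 ([AbsTopIII] §3), abc-iut-L4-t3 ([AbsTopIII] §5 Prop. 5.8).
[claim: Mochizuki2012, status: disputed] (IUTchII §1 Ex 1.8 (ii)-(ix), kurims pp.36-41) -/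
structure AbsTopMonoids : Type (u + 1) where
  /-- `O^⊳(G)` for `G ≅ G_k`, a commutative monoid with `G`-action -/
  Otri : IsoClass S.Gk → Type u
  [monOtri : ∀ G, CommMonoid (Otri G)]
  actOtri : ∀ G : IsoClass S.Gk, G.G →* MulAut (Otri G)
  /-- FUNCTORIALITY of `(*⊳)` (p. 36 "functorial group-theoretic algorithm"; p. 38 "the isomorphism …
  `(G ↷ O^×(G)) ≅ (G* ↷ O^×(G*))` induced by an isomorphism of topological groups `G ≅ G*`"): the induced
  isomorphisms satisfy the functor laws and are compatible with the actions -/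
  mapOtri : ∀ {G H : IsoClass S.Gk}, (G ⟶ H) → (Otri G ≃* Otri H)
  mapOtri_id : ∀ G : IsoClass S.Gk, mapOtri (𝟙 G) = MulEquiv.refl (Otri G)
  mapOtri_comp : ∀ {G H K : IsoClass S.Gk} (f : G ⟶ H) (g : H ⟶ K),
    mapOtri (f ≫ g) = (mapOtri f).trans (mapOtri g)
  mapOtri_equivariant : ∀ {G H : IsoClass S.Gk} (f : G ⟶ H) (g : G.G) (m : Otri G),
    mapOtri f (actOtri G g m) = actOtri H (IsoClass.homIso f g) (mapOtri f m)
  /-- `M_TM(Π)` for `Π ≅ Π^tp_{X̲̲_k}`, with `Π`-action, functorially in isomorphisms (same laws) -/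
  MTM : IsoClass S.PiX → Type u
  [monMTM : ∀ P, CommMonoid (MTM P)]
  actMTM : ∀ P : IsoClass S.PiX, P.G →* MulAut (MTM P)
  mapMTM : ∀ {P Q : IsoClass S.PiX}, (P ⟶ Q) → (MTM P ≃* MTM Q)
  mapMTM_id : ∀ P : IsoClass S.PiX, mapMTM (𝟙 P) = MulEquiv.refl (MTM P)
  mapMTM_comp : ∀ {P Q R : IsoClass S.PiX} (f : P ⟶ Q) (g : Q ⟶ R),
    mapMTM (f ≫ g) = (mapMTM f).trans (mapMTM g)
  mapMTM_equivariant : ∀ {P Q : IsoClass S.PiX} (f : P ⟶ Q) (x : P.G) (m : MTM P),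
    mapMTM f (actMTM P x m) = actMTM Q (IsoClass.homIso f x) (mapMTM f m)
  /-- `Δ ⊆ Π`, the group-theoretic subgroup corresponding to `Δ^tp_{X̲̲_k}` ([AbsAnab] Lem. 1.3.8): preserved by
  isomorphisms ("group-theoretic") and equal to `Δ_X = Ker(Π^tp_{X̲̲_k} ↠ G_k)` on the reference object -/
  Delta : ∀ P : IsoClass S.PiX, Subgroup P.G
  [Delta_normal : ∀ P, (Delta P).Normal]
  Delta_map : ∀ {P Q : IsoClass S.PiX} (f : P ⟶ Q),
    (Delta P).map (IsoClass.homIso f).toMulEquiv.toMonoidHom = Delta Q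
  Delta_base : Delta (IsoClass.base S.PiX) = S.DeltaX
  /-- `Π/Δ` as an object of `IsoClass G_k` -/
  quotIso : ∀ P : IsoClass S.PiX, Nonempty (TopGroup.quot P.G (Delta P) ≃ₜ* S.Gk)
  /-- `(*TM⊳)`: the tautological isomorphism `M_TM(Π) ≅ O^⊳(Π/Δ)`, `Π`-equivariantly -/
  tauto : ∀ P : IsoClass S.PiX, MTM P ≃* Otri ⟨TopGroup.quot P.G (Delta P), quotIso P⟩
  tauto_equivariant : ∀ (P : IsoClass S.PiX) (x : P.G) (m : MTM P),
    tauto P (actMTM P x m) =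
      actOtri ⟨TopGroup.quot P.G (Delta P), quotIso P⟩ (QuotientGroup.mk x) (tauto P m)
  /-- `Ism(G)`, "the compact topological group of `G`-isometries of `O^{×μ}(G)`" (as an abstract group
  acting on `O^{×μ}(G) = (O^⊳(G))ˣ / torsion`) -/
  Ism : IsoClass S.Gk → Type u
  [grpIsm : ∀ G, Group (Ism G)]
  actIsm : ∀ G : IsoClass S.Gk,
    Ism G →* MulAut ((Otri G)ˣ ⧸ CommGroup.torsion (Otri G)ˣ)
  /-- the natural homomorphism `Ẑ^× ↠ ℤ_p^× ↪ Ism(G)` restricted to a closed subgroup: recorded as a map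
  from the abstract twisting group used in (iii) -/
  toIsm : ∀ G : IsoClass S.Gk, ZHatUnits →* Ism G

namespace AbsTopMonoids

attribute [instance] monOtri monMTM Delta_normal grpIsm

variable {S} (A : AbsTopMonoids S)

/-- **IUTchII:Ex1.8(iii)** `(*×)`: `O^×(G)`, "the subgroups of invertible elements" (DEFINED as units).
[claim: Mochizuki2012, status: disputed] (IUTchII §1 Ex 1.8 (iii), kurims p.37) -/
abbrev Ounits (G : IsoClass S.Gk) : Type u := (A.Otri G)ˣ

/-- **IUTchII:Ex1.8(iv)** `(*μ)`: `O^μ(G)`, "the subgroups of torsion elements" (DEFINED).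
[claim: Mochizuki2012, status: disputed] (IUTchII §1 Ex 1.8 (iv), kurims p.38) -/
abbrev Omu (G : IsoClass S.Gk) : Subgroup (A.Ounits G) := CommGroup.torsion (A.Ounits G)

/-- **IUTchII:Ex1.8(iv)** `(*×μ)`: `O^{×μ}(G) := O^×(G)/O^μ(G)` (DEFINED).
[claim: Mochizuki2012, status: disputed] (IUTchII §1 Ex 1.8 (iv), kurims p.38) -/
abbrev Oxmu (G : IsoClass S.Gk) : Type u := A.Ounits G ⧸ A.Omu G

/-- **IUTchII:Ex1.8(iii)**/**(iv)** on the `Π`-side: `M^×_TM(Π)`, `M^μ_TM(Π)`, `M^{×μ}_TM(Π)` (DEFINED).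
[claim: Mochizuki2012, status: disputed] (IUTchII §1 Ex 1.8 (iii)(iv), kurims pp.37-38) -/
abbrev Mxmu (P : IsoClass S.PiX) : Type u := (A.MTM P)ˣ ⧸ CommGroup.torsion (A.MTM P)ˣ

/-- **IUTchII:Ex1.8(vii)** `(*gp)`: the groupification `O^gp(G)` (DEFINED via Mathlib's localisation at
`⊤`, i.e. the Grothendieck group of the commutative monoid). [claim: Mochizuki2012, status: disputed] (IUTchII §1 Ex 1.8 (vii), kurims p.40) -/
abbrev Ogp (G : IsoClass S.Gk) : Type u := Localization (⊤ : Submonoid (A.Otri G))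

/-- The `G`-invariants `O^×(G)^G` of the units (DEFINED). [claim: Mochizuki2012, status: disputed] (IUTchII §1 Ex 1.8 (ix), kurims p.41) -/
def unitsInvariants (G : IsoClass S.Gk) : Set (A.Ounits G) :=
  {u | ∀ g : G.G, Units.map (A.actOtri G g).toMonoidHom u = u}

/-- **IUTchII:Ex1.8(ix)** (kurims p. 41): the log-shell "`I(G) ⊆ O^{×μ}(G)` [i.e., `p⁻¹` times the image of the
`G`-invariants of `O^×(G)` in `O^{×μ}(G)` — cf. [AbsTopIII], Proposition 5.8, (ii)]" — DEFINED (`O^{×μ}` being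
torsion-free, "`p⁻¹` times" a subset is its preimage under `y ↦ y^p`; review of p407099).
[claim: Mochizuki2012, status: disputed] (IUTchII §1 Ex 1.8 (ix), kurims p.41) -/
def logShell (G : IsoClass S.Gk) : Set (A.Oxmu G) :=
  {y | y ^ S.p ∈ (QuotientGroup.mk : A.Ounits G → A.Oxmu G) '' A.unitsInvariants G}

end AbsTopMonoids

/-- **IUTchII:Ex1.8(vii)** (kurims p. 40): the algorithms `(*gp) Π ↦ (Π ↷ M^gp_TM(Π)); G ↦ (G ↷ O^gp(G))`
(groupifications) and `(*ĝp)` (inductive limits of profinite completions of the `J`-invariants), "a natural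
action of `Γ` on the underlying ind-topological modules of `M^ĝp_TM(Π), O^ĝp(G)`", and the
poly-isomorphism `α_ĝp : (Π ↷ M^ĝp_TM(Π)) ≅ (G ↷ O^ĝp(G))|_Π` "compatible … with the poly-isomorphism `α_×`
of (iii)". INTERFACE data over `AbsTopMonoids` (the profinite-completion functor is not in the tree):
`O^ĝp(G)` with the inclusion of `O^×(G)`, `M^ĝp_TM(Π)` with `M_TM(Π) → M^ĝp_TM(Π)`, the `Γ`-actions, and the
isomorphism `α_ĝp` (field `alphaGhat`, compatible with `α_×` on units: `alphaGhat_compat`) — so that the printed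
diagram `α_{⊳,×μ}` of (viii), `M_TM(Π) ↪ M^ĝp_TM(Π) ≅ O^ĝp(G)|_Π ↩ O^×(G)|_Π ↠ O^{×μ}(G)|_Π`, is composed of
`toMghat`, `alphaGhat`, `unitsToOghat` and the quotient map to `Oxmu`. NOT carried: the `Π`- and `G`-actions on
`M^ĝp_TM(Π)`, `O^ĝp(G)` (so the equivariance of `α_ĝp` is untyped here) — only the `Γ`-actions. TODO-merge:abc-iut-L4-t3. [claim: Mochizuki2012, status: disputed] (IUTchII §1 Ex 1.8 (vii), kurims p.40) -/
structure ProfiniteGroupifications {S : ThetaSetting.{u}} (A : AbsTopMonoids S) (Γ : Type u) [Group Γ] :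
    Type (u + 1) where
  /-- `O^ĝp(G)` -/
  Oghat : IsoClass S.Gk → Type u
  [grpOghat : ∀ G, CommGroup (Oghat G)]
  /-- `O^×(G) ↪ O^ĝp(G)` ("the natural inclusion" of (viii)) -/
  unitsToOghat : ∀ G, A.Ounits G →* Oghat G
  unitsToOghat_injective : ∀ G, Function.Injective (unitsToOghat G)
  /-- `M^ĝp_TM(Π)` with the natural map `M_TM(Π) → M^ĝp_TM(Π)` (a monoid need not inject into the profinite
  completion of its groupification in general; injectivity is not used below and not carried) -/
  Mghat : IsoClass S.PiX → Type u
  [grpMghat : ∀ P, CommGroup (Mghat P)]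
  toMghat : ∀ P, A.MTM P →* Mghat P
  /-- "a natural action of `Γ` on the underlying ind-topological modules" -/
  actΓO : ∀ G, Γ →* MulAut (Oghat G)
  actΓM : ∀ P, Γ →* MulAut (Mghat P)
  /-- `α_ĝp : (Π ↷ M^ĝp_TM(Π)) ≅ (G ↷ O^ĝp(G))|_Π` at `G = Π/Δ` (a representative of the poly-isomorphism; the
  middle arrow of the diagram `α_{⊳,×μ}` of (viii)) -/
  alphaGhat : ∀ P : IsoClass S.PiX, Mghat P ≃* Oghat ⟨TopGroup.quot P.G (A.Delta P), A.quotIso P⟩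
  /-- "compatible, relative to the natural inclusions, with `α_×` of (iii)": on units of `M_TM(Π)` the square
  through the tautological isomorphism `(*TM⊳)` commutes -/
  alphaGhat_compat : ∀ (P : IsoClass S.PiX) (m : (A.MTM P)ˣ),
    alphaGhat P (toMghat P m) = unitsToOghat _ (Units.map (A.tauto P).toMonoidHom m)

attribute [instance] ProfiniteGroupifications.grpOghat ProfiniteGroupifications.grpMghat

/-! ## Remark 1.8.1 -/

/-- **IUTchII:Rmk1.8.1** (kurims pp. 41–42): "no automorphism of `O^{×μ}(G)` induced by an element of
`Aut(G)` [e.g., an element of `G`, regarded as an inner automorphism of `G`] coincides with an automorphism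
of `O^{×μ}(G)` induced by an element of `Γ` that has nontrivial image in `ℤ_p^×`" (because the `p`-adic
logarithm of the cyclotomic character gives an `Aut(G)`-equivariant, `Γ`-equivariant surjection
`O^{×μ}(G) ↠ ℚ_p`, [AbsTopIII] Prop. 5.8 (i), [AbsAnab] Prop. 1.2.1 (vi)). Named `Prop` over the
interface: the `Aut(G)`-induced action on `O^{×μ}(G)` (transport of structure along `mapOtri` for
automorphisms) never agrees with the `Ism`-action of a unit of `Ẑ` acting nontrivially. ("Nontrivial image
in `ℤ_p^×`" is rendered as "acting nontrivially on `O^{×μ}(G)`", its operative content here.)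
[claim: Mochizuki2012, status: disputed] (IUTchII §1 Rmk 1.8.1, kurims pp.41-42) -/
def Rmk181_statement {S : ThetaSetting.{u}} (A : AbsTopMonoids S) : Prop :=
  ∀ (G : IsoClass S.Gk) (σ : G ⟶ G) (γ : ZHatUnits),
    A.actIsm G (A.toIsm G γ) ≠ 1 →
      ¬ ∀ x : A.Ounits G,
        (QuotientGroup.mk (Units.map (A.mapOtri σ).toMonoidHom x) : A.Oxmu G) =
          A.actIsm G (A.toIsm G γ) (QuotientGroup.mk x)

end Literature.IUT.HodgeArakelov
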